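import Literature.AlgebraicGeometry.HodgeTheory.DegreeOneHodgeTypes
import Literature.AlgebraicGeometry.Motives.HyperbolicWeilType
import Literature.AlgebraicGeometry.HodgeTheory.ChernCharacterBetti
import Literature.AlgebraicTopology.SingularHomology.CupProductProofs
import HarnessLib

/-!
# The signature bound for isotropic stable real subspaces of `H¹` (van Geemen's Lemma 5.2 (1), necessity)

Family `hodge`, layer `Literature/AlgebraicGeometry/HodgeTheory`. The linear algebra behind the
NECESSITY of the discriminant / signature condition in the "product trick" for abelian varieties of
Weil type (van Geemen, LNM 1594, Lemma 5.2 (1) with 5.3–5.4; Markman, arXiv:2509.23403 §11.5): on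
`V = H¹(X(ℂ); ℂ) = H^{1,0} ⊕ H^{0,1}` let `g^*` be the action of an endomorphism, `V_μ` an
eigenspace, `p_μ = dim (V_μ ∩ H^{1,0})`, `q_μ = dim (V_μ ∩ H^{0,1})`, and let `τ` be a linear
functional on the top cohomology such that the sesquilinear form `(x, y) ↦ τ (x ⌣ ȳ ⌣ P)` is
ANISOTROPIC on `H^{1,0}` (for `P = h^{n-1}`, `h` a polarization, this is the Hodge–Riemann bilinear
relation in degree one, `HodgeTheory.IsKaehlerClass.hodgeRiemann_one`). Then:

* `finrank_inf_eigenspace_le` — **a subspace `W ⊆ V` closed under complex conjugation on which the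
  bilinear form `(w, w') ↦ τ (w ⌣ w' ⌣ P)` vanishes identically satisfies
  `dim (W ∩ V_μ) ≤ min (p_μ, q_μ)`**: the projections of `W ∩ V_μ` to `H^{1,0}` and to `H^{0,1}`
  (which land in `V_μ ∩ H^{1,0}`, `V_μ ∩ H^{0,1}`, `HodgeTheory.eigenvector_components`) are
  injective, because a vector of `W` of pure type `(0,1)` (resp. `(1,0)`) pairs to zero with its own
  conjugate `∈ W`, contradicting anisotropy;
* `finrank_le_of_stable` — if moreover `g^* ∘ g^* = -d` on `V` (`d > 0`) and `W` is `g^*`-stable,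
  `dim W ≤ dim (W ∩ V_{i√d}) + dim (W ∩ V_{-i√d})`;
* `finrank_le_two_mul_min` — hence **`dim W ≤ 2 · min (p, q)`** for `(p, q) = (p_{i√d}, q_{i√d})`
  (`q_{-i√d} = p_{i√d}`, `p_{-i√d} = q_{i√d}` by conjugation,
  `HodgeTheory.finrank_eigenspace_inf_hodgeZeroOne_eq`). For a RATIONAL, `φ^*`-stable, `Q_h`-Lagrangian
  `W` of dimension `2N = dim_K H¹` ("hyperbolic Weil type", `Motives.IsHyperbolicWeilType`) this forces
  `p = q`: the space `(K^{2N}, H)` of van Geemen 5.2 (1) has an `N`-dimensional isotropic subspace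
  only if the signature of `H` is `(N, N)`.
* `polarizationPairingOne_eq_cupProduct_cupPowTwo` — the dictionary
  `Q_{h,j}(x, y) = Lʲ_h (x ⌣ y) = x ⌣ (y ⌣ hʲ)` between the tree's `Motives.polarizationPairingOne`
  (iterated Lefschetz operator, cup with `h` on the left) and the cup powers `cupPowTwo h j`
  (associativity and graded commutativity in even degrees).

Everything is proved; no definition and no named fact is introduced (D-0026).

## References

* [vanGeemen1994HodgeAV] B. van Geemen, An introduction to the Hodge conjecture for abelian
  varieties, LNM 1594 (1994), 4.9, Lemma 5.2 (1), 5.3, 5.4.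
* [Markman2025SurveySecant] E. Markman, arXiv:2509.23403, §11.5.
* [VoisinHodgeI2002] C. Voisin, Hodge Theory and Complex Algebraic Geometry I (CUP 2002), §6.1.3,
  Lemma 6.31, Thm. 6.32, §7.1.2.
* [HatcherAT2002] A. Hatcher, Algebraic Topology (2002), §3.2 (Thm. 3.11, associativity p. 211).
-/

noncomputable section

open CategoryTheory
open Literature.AlgebraicTopology.SingularHomology
open Literature.AlgebraicGeometry.Motives (IsSmoothProjective polarizationPairingOne)
open Literature.Geometry.Kaehler (lefschetzPow lefschetzOperator)

namespace Literature.AlgebraicGeometry.HodgeTheory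

section HodgeTheory

/-! ### `Lʲ_h (x ⌣ y) = x ⌣ (y ⌣ hʲ)` -/

section Dictionary

variable {Y : Type} [TopologicalSpace Y]

/-- **`Lʲ_κ c = c ⌣ κʲ` on `H²`**: the iterated Lefschetz operator (cup with `κ` on the left, `j`
times) against the cup power `κʲ = cupPowTwo κ j` (multiplying on the right), by associativity and
graded commutativity in even degrees. [cite: HatcherAT2002, §3.2 Thm. 3.11 and p. 211] -/
theorem lefschetzPow_two_eq_cupProduct_cupPowTwo (κ : singularCohomology ℂ ℂ Y 2) (j : ℕ)
    (c : singularCohomology ℂ ℂ Y 2) :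
    lefschetzPow κ j 2 c = cupProduct rfl c (cupPowTwo κ j) := by
  induction j with
  | zero => exact (cupProduct_one c).symm
  | succ j ih =>
    rw [Literature.Geometry.Kaehler.lefschetzPow_succ, LinearMap.comp_apply, ih,
      Literature.Geometry.Kaehler.lefschetzOperator_apply]
    have hsign : ((-1 : ℂ) ^ (2 * 2)) = 1 := by norm_num
    have hsign' : ((-1 : ℂ) ^ (2 * (2 * j))) = 1 := by
      rw [pow_mul]; norm_num
    -- `κ ⌣ (c ⌣ κʲ) = (κ ⌣ c) ⌣ κʲ = (c ⌣ κ) ⌣ κʲ = c ⌣ (κ ⌣ κʲ) = c ⌣ (κʲ ⌣ κ)`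
    rw [← cupProduct_assoc two_add_two rfl (by omega) (by omega) κ c (cupPowTwo κ j),
      cupProduct_gradedComm_holds ℂ Y two_add_two two_add_two κ c, hsign, one_smul,
      cupProduct_assoc two_add_two (show 2 + 2 * j = 2 * (j + 1) by omega) (by omega) rfl c κ
        (cupPowTwo κ j),
      cupProduct_gradedComm_holds ℂ Y (show 2 + 2 * j = 2 * (j + 1) by omega) (two_mul_add_two j) κ
        (cupPowTwo κ j), hsign', one_smul, cupPowTwo_succ]

/-- **`Q_{h,j}(x, y) = x ⌣ (y ⌣ hʲ)`**: the tree's polarization pairing `Lʲ_h (x ⌣ y)`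
(`Motives.polarizationPairingOne`) in the spelling `x ⌣ (y ⌣ hʲ)` with the cup power on the right
(`lefschetzPow_two_eq_cupProduct_cupPowTwo` and associativity). [cite: vanGeemen1994HodgeAV, 5.4 (5.4.1)]
[cite: HatcherAT2002, §3.2 p. 211] -/
theorem polarizationPairingOne_eq_cupProduct_cupPowTwo (X : Motives.SchemeOver ℂ) (h : complexBetti X 2)
    (j : ℕ) (x y : complexBetti X 1) :
    polarizationPairingOne X h j x y =
      cupProduct (show 1 + (1 + 2 * j) = 2 + 2 * j by omega) x (cupProduct rfl y (cupPowTwo h j)) := by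
  rw [Motives.polarizationPairingOne_apply, lefschetzPow_two_eq_cupProduct_cupPowTwo,
    cupProduct_assoc rfl rfl rfl (show 1 + (1 + 2 * j) = 2 + 2 * j by omega)]

end Dictionary

/-! ### The signature bound -/

section Signature

variable {n : ℕ} {X : Motives.SchemeOver ℂ} (hX : IsSmoothProjective n X) (g : X ⟶ X)

/-- **`dim (W ∩ V_μ) ≤ min (p_μ, q_μ)`** for a conjugation-closed subspace `W ⊆ H¹(X(ℂ); ℂ)` on which
`(w, w') ↦ τ (w ⌣ (w' ⌣ P))` vanishes identically, whenever `x ↦ τ (x ⌣ (x̄ ⌣ P))` has no zero on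
`H^{1,0} ∖ 0` (the Hodge–Riemann anisotropy): the projections of `W ∩ V_μ` to `H^{1,0}` along
`H^{0,1}` and to `H^{0,1}` along `H^{1,0}` land in `V_μ ∩ H^{1,0}`, `V_μ ∩ H^{0,1}`
(`eigenvector_components`) and are injective — a `w ∈ W` of pure type pairs to zero with `w̄ ∈ W`.
Van Geemen's Lemma 5.2 (1): an isotropic subspace of `(W_+, H|_{W_+})`, signature `(p, q)`, has
dimension `≤ min (p, q)`. [cite: vanGeemen1994HodgeAV, Lemma 5.2 (1) and 5.3]
[cite: VoisinHodgeI2002, Thm. 6.32] -/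
theorem finrank_inf_eigenspace_le [Module.Finite ℂ (complexBetti X 1)] (μ : ℂ) {k : ℕ}
    (P : complexBetti X k) (τ : complexBetti X (1 + (1 + k)) →ₗ[ℂ] ℂ)
    (hτ : ∀ x ∈ hodgeOneZero hX, x ≠ 0 →
      τ (cupProduct rfl x (cupProduct rfl (conjClass (Motives.ComplexPoints X) 1 x) P)) ≠ 0)
    (W : Submodule ℂ (complexBetti X 1))
    (hWc : ∀ w ∈ W, conjClass (Motives.ComplexPoints X) 1 w ∈ W)
    (hWQ : ∀ w ∈ W, ∀ w' ∈ W, τ (cupProduct rfl w (cupProduct rfl w' P)) = 0) :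
    Module.finrank ℂ ↥(W ⊓ Module.End.eigenspace (complexBetti.map g 1).hom μ) ≤
        Module.finrank ℂ ↥(Module.End.eigenspace (complexBetti.map g 1).hom μ ⊓ hodgeOneZero hX) ∧
      Module.finrank ℂ ↥(W ⊓ Module.End.eigenspace (complexBetti.map g 1).hom μ) ≤
        Module.finrank ℂ ↥(Module.End.eigenspace (complexBetti.map g 1).hom μ ⊓ hodgeZeroOne hX) := by
  have hc := isCompl_hodgeOneZero_hodgeZeroOne hX
  set E := Module.End.eigenspace (complexBetti.map g 1).hom μ with hE
  set π₁ := (hodgeOneZero hX).projection (hodgeZeroOne hX) hc with hπ₁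
  set π₂ := (hodgeZeroOne hX).projection (hodgeOneZero hX) hc.symm with hπ₂
  -- the components of an eigenvector are eigenvectors
  have hcomp : ∀ w ∈ E, π₁ w ∈ E ∧ π₂ w ∈ E := by
    intro w hw
    have h := eigenvector_components hX g μ (Module.End.mem_eigenspace_iff.1 hw)
      (Submodule.projection_add_projection_eq_self hc w) (Submodule.projection_apply_mem hc w)
      (Submodule.projection_apply_mem hc.symm w)
    exact ⟨Module.End.mem_eigenspace_iff.2 h.1, Module.End.mem_eigenspace_iff.2 h.2⟩
  -- a vector of `W` of pure type `(0,1)` vanishes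
  have h01 : ∀ w ∈ W, w ∈ hodgeZeroOne hX → w = 0 := by
    intro w hw hw01
    by_contra hw0
    set w' := conjClass (Motives.ComplexPoints X) 1 w with hw'
    have hw'0 : w' ≠ 0 := fun h ↦ hw0 (by
      rw [← conjClass_conjClass (Y := Motives.ComplexPoints X) w, ← hw', h, conjClass_zero])
    have h1 := hτ w' (conjClass_mem_hodgeOneZero hX hw01) hw'0
    rw [hw', conjClass_conjClass] at h1
    exact h1 (hWQ _ (hWc w hw) w hw)
  -- a vector of `W` of pure type `(1,0)` vanishes
  have h10 : ∀ w ∈ W, w ∈ hodgeOneZero hX → w = 0 := by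
    intro w hw hw10
    by_contra hw0
    exact hτ w hw10 hw0 (hWQ w hw _ (hWc w hw))
  constructor
  · -- project to `H^{1,0}`
    let f : ↥(W ⊓ E) →ₗ[ℂ] ↥(E ⊓ hodgeOneZero hX) :=
      { toFun := fun w ↦ ⟨π₁ w, (hcomp w w.2.2).1, Submodule.projection_apply_mem hc _⟩
        map_add' := fun w w' ↦ Subtype.ext (by simp [map_add])
        map_smul' := fun c w ↦ Subtype.ext (by simp [map_smul]) }
    refine LinearMap.finrank_le_finrank_of_injective (f := f) fun w w' hww ↦ ?_
    have h0 : π₁ (w - w' : complexBetti X 1) = 0 := by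
      have := congrArg Subtype.val hww
      simp only [f, LinearMap.coe_mk, AddHom.coe_mk] at this
      rw [map_sub, this, sub_self]
    have hmem : (w - w' : complexBetti X 1) ∈ hodgeZeroOne hX :=
      (Submodule.projection_apply_eq_zero_iff hc).1 h0
    have hz := h01 _ (Submodule.sub_mem _ w.2.1 w'.2.1) hmem
    exact Subtype.ext (sub_eq_zero.1 hz)
  · -- project to `H^{0,1}`
    let f : ↥(W ⊓ E) →ₗ[ℂ] ↥(E ⊓ hodgeZeroOne hX) :=
      { toFun := fun w ↦ ⟨π₂ w, (hcomp w w.2.2).2, Submodule.projection_apply_mem hc.symm _⟩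
        map_add' := fun w w' ↦ Subtype.ext (by simp [map_add])
        map_smul' := fun c w ↦ Subtype.ext (by simp [map_smul]) }
    refine LinearMap.finrank_le_finrank_of_injective (f := f) fun w w' hww ↦ ?_
    have h0 : π₂ (w - w' : complexBetti X 1) = 0 := by
      have := congrArg Subtype.val hww
      simp only [f, LinearMap.coe_mk, AddHom.coe_mk] at this
      rw [map_sub, this, sub_self]
    have hmem : (w - w' : complexBetti X 1) ∈ hodgeOneZero hX :=
      (Submodule.projection_apply_eq_zero_iff hc.symm).1 h0
    have hz := h10 _ (Submodule.sub_mem _ w.2.1 w'.2.1) hmem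
    exact Subtype.ext (sub_eq_zero.1 hz)

omit hX in
/-- **`dim W ≤ dim (W ∩ V_{i√d}) + dim (W ∩ V_{-i√d})`** for a `g^*`-stable `W` when
`g^* g^* = -d` on `H¹` (`d > 0`): `w = w₊ + w₋` with `w_± = ½ (w ∓ (i/√d) g^* w) ∈ W ∩ V_{±i√d}`.
[cite: vanGeemen1994HodgeAV, 5.3 and proof of Lemma 5.2] -/
theorem finrank_le_of_stable [Module.Finite ℂ (complexBetti X 1)] {d : ℕ} (hd : 0 < d)
    (hT2 : ∀ v : complexBetti X 1, (complexBetti.map g 1).hom ((complexBetti.map g 1).hom v) = -((d : ℂ) • v))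
    (W : Submodule ℂ (complexBetti X 1)) (hWT : ∀ w ∈ W, (complexBetti.map g 1).hom w ∈ W) :
    Module.finrank ℂ W ≤
      Module.finrank ℂ ↥(W ⊓ Module.End.eigenspace (complexBetti.map g 1).hom (Complex.I * (Real.sqrt d : ℂ))) +
        Module.finrank ℂ ↥(W ⊓ Module.End.eigenspace (complexBetti.map g 1).hom (-(Complex.I * (Real.sqrt d : ℂ)))) := by
  set T := (complexBetti.map g 1).hom with hT
  set μ : ℂ := Complex.I * (Real.sqrt d : ℂ) with hμ
  have hsq : (Real.sqrt d : ℂ) * (Real.sqrt d : ℂ) = d := by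
    rw [← Complex.ofReal_mul, Real.mul_self_sqrt (Nat.cast_nonneg d), Complex.ofReal_natCast]
  have hs0 : (Real.sqrt d : ℂ) ≠ 0 := by
    rw [Ne, Complex.ofReal_eq_zero, Real.sqrt_eq_zero (Nat.cast_nonneg d)]
    exact_mod_cast hd.ne'
  have hμ2 : μ * μ = -(d : ℂ) := by
    rw [hμ, mul_mul_mul_comm, Complex.I_mul_I, hsq, neg_one_mul]
  have hμ0 : μ ≠ 0 := mul_ne_zero Complex.I_ne_zero hs0
  -- the two projectors `w ↦ ½ (w ± μ⁻¹ g^* w)`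
  have key : μ⁻¹ * (d : ℂ) = -μ := by
    calc μ⁻¹ * (d : ℂ) = μ⁻¹ * (-(μ * μ)) := by rw [hμ2, neg_neg]
      _ = -μ := by rw [mul_neg, ← mul_assoc, inv_mul_cancel₀ hμ0, one_mul]
  have hsplit : ∀ w : complexBetti X 1,
      (2⁻¹ : ℂ) • (w + μ⁻¹ • T w) + (2⁻¹ : ℂ) • (w - μ⁻¹ • T w) = w := by
    intro w
    rw [← smul_add, add_add_sub_cancel, ← two_smul ℂ w, smul_smul]
    norm_num
  have hplus : ∀ w : complexBetti X 1, T (w + μ⁻¹ • T w) = μ • (w + μ⁻¹ • T w) := by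
    intro w
    rw [map_add, map_smul, hT2, smul_neg, smul_smul, key, neg_smul, neg_neg, smul_add, smul_smul,
      mul_inv_cancel₀ hμ0, one_smul, add_comm]
  have hminus : ∀ w : complexBetti X 1, T (w - μ⁻¹ • T w) = (-μ) • (w - μ⁻¹ • T w) := by
    intro w
    rw [map_sub, map_smul, hT2, smul_neg, smul_smul, key, neg_smul, neg_neg, neg_smul, smul_sub,
      smul_smul, mul_inv_cancel₀ hμ0, one_smul, neg_sub]
  have hle : W ≤ W ⊓ Module.End.eigenspace T μ ⊔ W ⊓ Module.End.eigenspace T (-μ) := by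
    intro w hw
    have hTw : T w ∈ W := hWT w hw
    rw [← hsplit w]
    refine Submodule.add_mem_sup ⟨?_, Module.End.mem_eigenspace_iff.2 ?_⟩
      ⟨?_, Module.End.mem_eigenspace_iff.2 ?_⟩
    · exact Submodule.smul_mem _ _ (Submodule.add_mem _ hw (Submodule.smul_mem _ _ hTw))
    · rw [map_smul, hplus, smul_comm]
    · exact Submodule.smul_mem _ _ (Submodule.sub_mem _ hw (Submodule.smul_mem _ _ hTw))
    · rw [map_smul, hminus, smul_comm]
  exact (Submodule.finrank_mono hle).trans (Submodule.finrank_add_le_finrank_add_finrank _ _)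

/-- `conj (i√d) = -i√d`. [folklore] -/
theorem conj_I_mul_sqrt (d : ℕ) :
    (starRingEnd ℂ) (Complex.I * (Real.sqrt d : ℂ)) = -(Complex.I * (Real.sqrt d : ℂ)) := by
  rw [map_mul, Complex.conj_I, Complex.conj_ofReal, neg_mul]

/-- **The signature bound.** Let `X` be smooth projective, `g : X ⟶ X` with `g^* g^* = -d` on
`H¹(X(ℂ); ℂ)` (`d > 0`), `V_± = V_{±i√d}`, `(p, q) = (dim V₊ ∩ H^{1,0}, dim V₊ ∩ H^{0,1})`, and let
`τ` be a functional with `τ (x ⌣ x̄ ⌣ P) ≠ 0` for all non-zero `x ∈ H^{1,0}` (Hodge–Riemann in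
degree one). Then every `g^*`-stable, conjugation-closed subspace `W ⊆ H¹(X(ℂ); ℂ)` on which
`(w, w') ↦ τ (w ⌣ w' ⌣ P)` vanishes has **`dim W ≤ 2 min (p, q)`** (`W = W₊ ⊕ W₋`,
`dim W_± ≤ min (p_±, q_±)` and `(p₋, q₋) = (q, p)` by conjugation). With `W` the span of a rational
Lagrangian `g^*`-stable `2N`-frame (`Motives.IsHyperbolicWeilType`), `2N = p + q` forces `p = q = N`:
the necessity half of van Geemen's Lemma 5.2 (1) / Markman §11.5.
[cite: vanGeemen1994HodgeAV, Lemma 5.2 (1), 5.3, 5.4] [cite: Markman2025SurveySecant, §11.5] -/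
theorem finrank_le_two_mul_min [Module.Finite ℂ (complexBetti X 1)] {d : ℕ} (hd : 0 < d)
    (hT2 : ∀ v : complexBetti X 1, (complexBetti.map g 1).hom ((complexBetti.map g 1).hom v) = -((d : ℂ) • v))
    {k : ℕ} (P : complexBetti X k) (τ : complexBetti X (1 + (1 + k)) →ₗ[ℂ] ℂ)
    (hτ : ∀ x ∈ hodgeOneZero hX, x ≠ 0 →
      τ (cupProduct rfl x (cupProduct rfl (conjClass (Motives.ComplexPoints X) 1 x) P)) ≠ 0)
    (W : Submodule ℂ (complexBetti X 1)) (hWT : ∀ w ∈ W, (complexBetti.map g 1).hom w ∈ W)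
    (hWc : ∀ w ∈ W, conjClass (Motives.ComplexPoints X) 1 w ∈ W)
    (hWQ : ∀ w ∈ W, ∀ w' ∈ W, τ (cupProduct rfl w (cupProduct rfl w' P)) = 0) :
    Module.finrank ℂ W ≤ 2 * min
      (Module.finrank ℂ ↥(Module.End.eigenspace (complexBetti.map g 1).hom (Complex.I * (Real.sqrt d : ℂ)) ⊓
        hodgeOneZero hX))
      (Module.finrank ℂ ↥(Module.End.eigenspace (complexBetti.map g 1).hom (Complex.I * (Real.sqrt d : ℂ)) ⊓
        hodgeZeroOne hX)) := by
  set μ : ℂ := Complex.I * (Real.sqrt d : ℂ) with hμ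
  have h1 := finrank_inf_eigenspace_le hX g μ P τ hτ W hWc hWQ
  have h2 := finrank_inf_eigenspace_le hX g (-μ) P τ hτ W hWc hWQ
  have h3 : Module.finrank ℂ W ≤ Module.finrank ℂ ↥(W ⊓ Module.End.eigenspace (complexBetti.map g 1).hom μ) +
      Module.finrank ℂ ↥(W ⊓ Module.End.eigenspace (complexBetti.map g 1).hom (-μ)) :=
    finrank_le_of_stable g hd hT2 W hWT
  -- `(p₋, q₋) = (q, p)`
  have hconj : (starRingEnd ℂ) μ = -μ := conj_I_mul_sqrt d
  have hconj' : (starRingEnd ℂ) (-μ) = μ := by rw [map_neg, hconj, neg_neg]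
  have hq : Module.finrank ℂ ↥(Module.End.eigenspace (complexBetti.map g 1).hom (-μ) ⊓ hodgeZeroOne hX) =
      Module.finrank ℂ ↥(Module.End.eigenspace (complexBetti.map g 1).hom μ ⊓ hodgeOneZero hX) := by
    rw [← hconj]; exact finrank_eigenspace_inf_hodgeZeroOne_eq hX g μ
  have hp : Module.finrank ℂ ↥(Module.End.eigenspace (complexBetti.map g 1).hom (-μ) ⊓ hodgeOneZero hX) =
      Module.finrank ℂ ↥(Module.End.eigenspace (complexBetti.map g 1).hom μ ⊓ hodgeZeroOne hX) := by
    rw [← finrank_eigenspace_inf_hodgeZeroOne_eq hX g (-μ), hconj']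
  rw [hq, hp] at h2
  omega

end Signature

end HodgeTheory

end Literature.AlgebraicGeometry.HodgeTheory

end
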